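import Mathlib
import Summits.NavierStokesRegularity.NavierStokesRegularity.Theorems.FilamentSkeletonRssStadiumSegmentCauchy

/-!
# Route `FilamentSkeletonRss` · twin child cruxes `TangentSkeletonNearStraight` (stmt-28295) / `TangentSkeletonNearStraightL` (stmt-23320) ·
# shared registered stub `stub_stripPropagation : StripPropagation` — brick: ε-TUBE DEFORMATION OF A SLOPED SOURCE SEGMENT

Sequel of `Theorems.StadiumSegmentCauchy`.  A contour FREEZE for a target-dependent polygonal source contour with a SLOPED piece (the descent
`ζ(f) = (x₀ + hs/5 + (3hs/10)f) + i·Y(1−f)` of the quarter-width programme, `Theorems.StadiumCornerRightNear`) must replace the segment `[p, q]`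
belonging to one target by the nearby segment `[p', q']` belonging to a nearby target, at the cost of the two short junctions `[p, p']`, `[q, q']`.
Mathlib's Cauchy theorem is for rectangles; the disc primitives of `Theorems.StadiumSegmentCauchy` give the general statement by SUBDIVISION:

* §1 `segmentIntegral_ladder` — abstract ladder: two point sequences `P, P'` whose consecutive rungs `P k, P (k+1), P' k, P' (k+1)` lie in discs of
  holomorphy telescope: `Σ_{k<n} [P k, P (k+1)] + [P n, P' n] = [P 0, P' 0] + Σ_{k<n} [P' k, P' (k+1)]`;
* §2 `segmentIntegral_subdivide` — the `n` equal sub-segments of `[p, q]` add up to `[p, q]` (substitution + interval additivity; continuity only);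
* §3 `segmentIntegral_tube_shift` — **the tube deformation**: if `f` is holomorphic on a set containing the open `δ`-discs about every point of `[p, q]`
  and `dist p' p, dist q' q < δ/2`, then `[p,q] + [q,q'] = [p,p'] + [p',q']` as segment integrals `∫₀¹ (b − a) • f(a + t(b − a)) dt`.

Values in any complete complex normed space (`ℂ`, `Fin 3 → ℂ`).  HONEST FRAMING: complex-analysis bricks for the bookkeeping of a HYPOTHETICAL filament
skeleton on the NEGATIVE side of a MODEL route; no stub of 28295 / 23320 is closed here; nothing here bears on Navier–Stokes regularity or blow-up.
`--supports stmt-NavierStokesRegularity-28295`.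
-/

set_option linter.dupNamespace false

noncomputable section

namespace Summit.NavierStokesRegularity.NavierStokesRegularity.Theorems.StadiumSegmentTube

open Set Metric MeasureTheory Complex Finset
open Summit.NavierStokesRegularity.NavierStokesRegularity.Theorems.StadiumSegmentCauchy

variable {E : Type*} [NormedAddCommGroup E] [NormedSpace ℝ E] [NormedSpace ℂ E] [IsScalarTower ℝ ℂ E] [CompleteSpace E]

/-! ## §1  The abstract ladder -/

/-- **Ladder telescoping.**  `f` holomorphic on `U`; two point sequences `P, P'`; for every `k < n` the disc `ball (P k) (ρ k) ⊆ U` contains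
`P (k+1)`, `P' k`, `P' (k+1)`.  Then `Σ_{k<n} [P k, P (k+1)] + [P n, P' n] = [P 0, P' 0] + Σ_{k<n} [P' k, P' (k+1)]`. [folklore] -/
theorem segmentIntegral_ladder {U : Set ℂ} {f : ℂ → E} (hf : DifferentiableOn ℂ f U) (P P' : ℕ → ℂ) (ρ : ℕ → ℝ) :
    ∀ n : ℕ, (∀ k < n, ball (P k) (ρ k) ⊆ U) → (∀ k < n, P (k+1) ∈ ball (P k) (ρ k)) →
      (∀ k < n, P' k ∈ ball (P k) (ρ k)) → (∀ k < n, P' (k+1) ∈ ball (P k) (ρ k)) →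
      (∑ k ∈ range n, ∫ t in (0:ℝ)..1, (P (k+1) - P k) • f (P k + (t : ℂ) * (P (k+1) - P k))) +
          (∫ t in (0:ℝ)..1, (P' n - P n) • f (P n + (t : ℂ) * (P' n - P n))) =
        (∫ t in (0:ℝ)..1, (P' 0 - P 0) • f (P 0 + (t : ℂ) * (P' 0 - P 0))) +
          ∑ k ∈ range n, ∫ t in (0:ℝ)..1, (P' (k+1) - P' k) • f (P' k + (t : ℂ) * (P' (k+1) - P' k)) := by
  intro n
  induction n with
  | zero => intro _ _ _ _; simp
  | succ n ih =>
    intro hU h1 h2 h3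
    have ih' := ih (fun k hk => hU k (by omega)) (fun k hk => h1 k (by omega)) (fun k hk => h2 k (by omega))
      (fun k hk => h3 k (by omega))
    -- the last rung: the quadrilateral `P n, P (n+1), P' (n+1), P' n` inside `ball (P n) (ρ n)`
    have hρ : 0 < ρ n := by
      have := h1 n (by omega)
      rw [mem_ball] at this
      exact lt_of_le_of_lt dist_nonneg this
    have hfn : DifferentiableOn ℂ f (ball (P n) (ρ n)) := hf.mono (hU n (by omega))
    have step := segmentIntegral_two_paths_ball hfn (mem_ball_self hρ) (h1 n (by omega)) (h2 n (by omega)) (h3 n (by omega))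
    rw [sum_range_succ, sum_range_succ, add_assoc, step, ← add_assoc, ih', add_assoc]

/-! ## §2  Subdivision of a segment into `n` equal pieces -/

omit [CompleteSpace E] in
/-- One sub-segment of the `n`-subdivision, as an integral over `[k/n, (k+1)/n]` of the global parametrisation. [folklore] -/
theorem subsegment_eq_integral (f : ℂ → E) (p q : ℂ) {n : ℕ} (hn : 0 < n) (k : ℕ) :
    (∫ t in (0:ℝ)..1, ((p + (((k + 1 : ℝ) / n : ℝ) : ℂ) * (q - p)) - (p + (((k : ℝ) / n : ℝ) : ℂ) * (q - p))) •
        f ((p + (((k : ℝ) / n : ℝ) : ℂ) * (q - p)) + (t : ℂ) *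
          ((p + (((k + 1 : ℝ) / n : ℝ) : ℂ) * (q - p)) - (p + (((k : ℝ) / n : ℝ) : ℂ) * (q - p))))) =
      ∫ s in ((k : ℝ) / n)..((k + 1 : ℝ) / n), (q - p) • f (p + (s : ℂ) * (q - p)) := by
  have hn' : (0 : ℝ) < n := Nat.cast_pos.mpr hn
  have key : ∀ (r : ℝ) (v : E), (r : ℂ) • v = r • v := fun r v => by
    rw [show ((r : ℂ)) = r • (1:ℂ) by rw [Complex.real_smul, mul_one], smul_assoc, one_smul]
  have hdir : (p + (((k + 1 : ℝ) / n : ℝ) : ℂ) * (q - p)) - (p + (((k : ℝ) / n : ℝ) : ℂ) * (q - p)) =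
      (((1 : ℝ) / n : ℝ) : ℂ) * (q - p) := by
    push_cast; ring
  have hpt : ∀ t : ℝ, (p + (((k : ℝ) / n : ℝ) : ℂ) * (q - p)) + (t : ℂ) * ((((1 : ℝ) / n : ℝ) : ℂ) * (q - p)) =
      p + ((((1 : ℝ) / n) * t + (k : ℝ) / n : ℝ) : ℂ) * (q - p) := by
    intro t; push_cast; ring
  simp_rw [hdir, hpt, mul_smul, key]
  rw [intervalIntegral.integral_smul,
    intervalIntegral.smul_integral_comp_mul_add (fun s : ℝ => (q - p) • f (p + (s : ℂ) * (q - p))) ((1 : ℝ) / n) ((k : ℝ) / n)]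
  congr 1
  · simp
  · ring

omit [CompleteSpace E] in
/-- **Subdivision.**  For `f` continuous on a set containing the segment `[p, q]`, the `n` equal sub-segments add up to the whole:
`Σ_{k<n} [P k, P (k+1)] = [p, q]`, `P k = p + (k/n)(q − p)`. [folklore] -/
theorem segmentIntegral_subdivide {U : Set ℂ} {f : ℂ → E} (hf : ContinuousOn f U) {p q : ℂ}
    (hseg : ∀ t ∈ Icc (0:ℝ) 1, p + (t : ℂ) * (q - p) ∈ U) {n : ℕ} (hn : 0 < n) :
    (∑ k ∈ range n, ∫ t in (0:ℝ)..1,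
        ((p + (((k + 1 : ℝ) / n : ℝ) : ℂ) * (q - p)) - (p + (((k : ℝ) / n : ℝ) : ℂ) * (q - p))) •
          f ((p + (((k : ℝ) / n : ℝ) : ℂ) * (q - p)) + (t : ℂ) *
            ((p + (((k + 1 : ℝ) / n : ℝ) : ℂ) * (q - p)) - (p + (((k : ℝ) / n : ℝ) : ℂ) * (q - p))))) =
      ∫ t in (0:ℝ)..1, (q - p) • f (p + (t : ℂ) * (q - p)) := by
  have hn' : (0 : ℝ) < n := Nat.cast_pos.mpr hn
  simp_rw [subsegment_eq_integral f p q hn]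
  have hcont : ContinuousOn (fun s : ℝ => (q - p) • f (p + (s : ℂ) * (q - p))) (Icc (0:ℝ) 1) :=
    continuousOn_const.smul (hf.comp (continuous_affinePath p q).continuousOn fun t ht => hseg t ht)
  have hint : ∀ k < n, IntervalIntegrable (fun s : ℝ => (q - p) • f (p + (s : ℂ) * (q - p))) volume
      ((fun k : ℕ => (k : ℝ) / n) k) ((fun k : ℕ => (k : ℝ) / n) (k + 1)) := by
    intro k hk
    refine (hcont.mono ?_).intervalIntegrable
    have h0 : 0 ≤ (k : ℝ) / n := by positivity
    have h1 : ((k + 1 : ℕ) : ℝ) / n ≤ 1 := by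
      rw [div_le_one hn']; exact_mod_cast hk
    have hle : (k : ℝ) / n ≤ ((k + 1 : ℕ) : ℝ) / n := by
      gcongr; simp
    rw [uIcc_of_le hle]
    exact Icc_subset_Icc h0 h1
  have hsum := intervalIntegral.sum_integral_adjacent_intervals hint
  simp only [Nat.cast_zero, zero_div, Nat.cast_add, Nat.cast_one] at hsum
  rw [show ∑ k ∈ range n, ∫ s in ((k : ℝ) / n)..((k + 1 : ℝ) / n), (q - p) • f (p + (s : ℂ) * (q - p)) =
      ∑ k ∈ range n, ∫ s in ((k : ℝ) / n)..(((k : ℝ) + 1) / n), (q - p) • f (p + (s : ℂ) * (q - p)) from rfl, hsum,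
    div_self hn'.ne']

/-! ## §3  The tube deformation -/

/-- Corresponding points of two segments are no farther apart than the worse pair of endpoints. [folklore] -/
theorem dist_corresponding_le (p q p' q' : ℂ) {s : ℝ} (hs0 : 0 ≤ s) (hs1 : s ≤ 1) :
    dist (p' + (s : ℂ) * (q' - p')) (p + (s : ℂ) * (q - p)) ≤ max (dist p' p) (dist q' q) := by
  rw [dist_eq_norm, dist_eq_norm, dist_eq_norm]
  have hid : (p' + (s : ℂ) * (q' - p')) - (p + (s : ℂ) * (q - p)) = ((1 - s : ℝ) : ℂ) * (p' - p) + (s : ℂ) * (q' - q) := by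
    push_cast; ring
  rw [hid]
  calc ‖((1 - s : ℝ) : ℂ) * (p' - p) + (s : ℂ) * (q' - q)‖
      ≤ ‖((1 - s : ℝ) : ℂ) * (p' - p)‖ + ‖(s : ℂ) * (q' - q)‖ := norm_add_le _ _
    _ = (1 - s) * ‖p' - p‖ + s * ‖q' - q‖ := by
        rw [norm_mul, norm_mul, Complex.norm_real, Complex.norm_real, Real.norm_of_nonneg (by linarith),
          Real.norm_of_nonneg hs0]
    _ ≤ (1 - s) * max ‖p' - p‖ ‖q' - q‖ + s * max ‖p' - p‖ ‖q' - q‖ :=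
        add_le_add (mul_le_mul_of_nonneg_left (le_max_left _ _) (by linarith))
          (mul_le_mul_of_nonneg_left (le_max_right _ _) hs0)
    _ = max ‖p' - p‖ ‖q' - q‖ := by ring

/-- **The ε-tube deformation of a (sloped) segment.**  Let `f` be holomorphic on `U`, and let the open `δ`-disc about every point of the segment
`[p, q]` lie in `U`.  If `dist p' p < δ/2` and `dist q' q < δ/2`, then
`[p, q] + [q, q'] = [p, p'] + [p', q']`  (segment integrals `∫₀¹ (b − a) • f(a + t(b − a)) dt`).
Proof: subdivide both segments into `n > 2‖q − p‖/δ` rungs; each quadrilateral of consecutive rungs lies in the `δ`-disc about `P k`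
(`Theorems.StadiumSegmentCauchy.segmentIntegral_two_paths_ball`); telescope (`segmentIntegral_ladder`) and re-assemble (`segmentIntegral_subdivide`).
[folklore; Cauchy's theorem by subdivision] -/
theorem segmentIntegral_tube_shift {U : Set ℂ} {f : ℂ → E} (hf : DifferentiableOn ℂ f U) {p q p' q' : ℂ} {δ : ℝ}
    (hδ : 0 < δ) (htube : ∀ t ∈ Icc (0:ℝ) 1, ball (p + (t : ℂ) * (q - p)) δ ⊆ U)
    (hp' : dist p' p < δ / 2) (hq' : dist q' q < δ / 2) :
    (∫ t in (0:ℝ)..1, (q - p) • f (p + (t : ℂ) * (q - p))) + (∫ t in (0:ℝ)..1, (q' - q) • f (q + (t : ℂ) * (q' - q))) =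
      (∫ t in (0:ℝ)..1, (p' - p) • f (p + (t : ℂ) * (p' - p))) +
        (∫ t in (0:ℝ)..1, (q' - p') • f (p' + (t : ℂ) * (q' - p'))) := by
  -- the number of rungs
  set n : ℕ := ⌈2 * ‖q - p‖ / δ⌉₊ + 1 with hndef
  have hn : 0 < n := Nat.succ_pos _
  have hn' : (0 : ℝ) < n := Nat.cast_pos.mpr hn
  have hnlarge : 2 * ‖q - p‖ / δ < n := by
    have := Nat.le_ceil (2 * ‖q - p‖ / δ)
    rw [hndef]; push_cast; linarith
  have hstep : ‖q - p‖ / n < δ / 2 := by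
    rw [div_lt_iff₀ hn']
    rw [div_lt_iff₀ hδ] at hnlarge
    linarith
  set η : ℝ := max (dist p' p) (dist q' q) with hη
  have hηδ : η < δ / 2 := max_lt hp' hq'
  -- the two ladders
  set P : ℕ → ℂ := fun k => p + (((k : ℝ) / n : ℝ) : ℂ) * (q - p) with hP
  set P' : ℕ → ℂ := fun k => p' + (((k : ℝ) / n : ℝ) : ℂ) * (q' - p') with hP'
  have hkn : ∀ k : ℕ, k ≤ n → (k : ℝ) / n ∈ Icc (0:ℝ) 1 := fun k hk =>
    ⟨by positivity, by rw [div_le_one hn']; exact_mod_cast hk⟩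
  have hPP' : ∀ k : ℕ, k ≤ n → dist (P' k) (P k) ≤ η := fun k hk =>
    dist_corresponding_le p q p' q' (hkn k hk).1 (hkn k hk).2
  have hPsucc : ∀ k : ℕ, dist (P (k+1)) (P k) = ‖q - p‖ / n := by
    intro k
    rw [dist_eq_norm, hP]
    simp only
    rw [show p + ((((k + 1 : ℕ) : ℝ) / n : ℝ) : ℂ) * (q - p) - (p + (((k : ℝ) / n : ℝ) : ℂ) * (q - p)) =
      (((1 : ℝ) / n : ℝ) : ℂ) * (q - p) by push_cast; field_simp; ring, norm_mul, Complex.norm_real,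
      Real.norm_of_nonneg (by positivity)]
    field_simp
  have hU : ∀ k < n, ball (P k) δ ⊆ U := fun k hk => htube _ (hkn k hk.le)
  have h1 : ∀ k < n, P (k+1) ∈ ball (P k) δ := fun k hk => by
    rw [mem_ball, hPsucc]; linarith
  have h2 : ∀ k < n, P' k ∈ ball (P k) δ := fun k hk => by
    rw [mem_ball]; linarith [hPP' k hk.le]
  have h3 : ∀ k < n, P' (k+1) ∈ ball (P k) δ := fun k hk => by
    rw [mem_ball]
    calc dist (P' (k+1)) (P k) ≤ dist (P' (k+1)) (P (k+1)) + dist (P (k+1)) (P k) := dist_triangle _ _ _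
      _ < δ / 2 + δ / 2 := by
          have := hPP' (k+1) (by omega); rw [hPsucc]; linarith
      _ = δ := by ring
  have hlad := segmentIntegral_ladder hf P P' (fun _ => δ) n hU h1 h2 h3
  -- endpoints of the ladders
  have hP0 : P 0 = p := by simp [hP]
  have hP'0 : P' 0 = p' := by simp [hP']
  have hPn : P n = q := by simp [hP]
  have hP'n : P' n = q' := by simp [hP']
  -- re-assemble the two subdivided segments
  have hsegU : ∀ t ∈ Icc (0:ℝ) 1, p + (t : ℂ) * (q - p) ∈ U := fun t ht => htube t ht (mem_ball_self hδ)
  have hsegU' : ∀ t ∈ Icc (0:ℝ) 1, p' + (t : ℂ) * (q' - p') ∈ U := by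
    intro t ht
    refine htube t ht ?_
    rw [mem_ball]
    have := dist_corresponding_le p q p' q' ht.1 ht.2
    linarith
  have hA := segmentIntegral_subdivide hf.continuousOn hsegU hn
  have hB := segmentIntegral_subdivide hf.continuousOn hsegU' hn
  have hA' : (∑ k ∈ range n, ∫ t in (0:ℝ)..1, (P (k+1) - P k) • f (P k + (t : ℂ) * (P (k+1) - P k))) =
      ∫ t in (0:ℝ)..1, (q - p) • f (p + (t : ℂ) * (q - p)) := by
    rw [← hA]
    refine sum_congr rfl fun k _ => ?_
    simp only [hP, Nat.cast_add, Nat.cast_one]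
  have hB' : (∑ k ∈ range n, ∫ t in (0:ℝ)..1, (P' (k+1) - P' k) • f (P' k + (t : ℂ) * (P' (k+1) - P' k))) =
      ∫ t in (0:ℝ)..1, (q' - p') • f (p' + (t : ℂ) * (q' - p')) := by
    rw [← hB]
    refine sum_congr rfl fun k _ => ?_
    simp only [hP', Nat.cast_add, Nat.cast_one]
  rw [hA', hB', hP0, hP'0, hPn, hP'n] at hlad
  exact hlad

end Summit.NavierStokesRegularity.NavierStokesRegularity.Theorems.StadiumSegmentTube
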